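import Mathlib
import Literature.NumberTheory.LFunctions.Zhang2022.Section14Eq143Assembly
import Literature.NumberTheory.LFunctions.Zhang2022.SkeletonWindowPowers
import HarnessLib

/-!
# Zhang (2022) §14, (14.3) at GENERAL `β`: `Θ₂(β,𝐤*,𝐚*) = Σ_{ψ∈Ψ} (p_ψt₀)^β Ĩ₂(ψ) + o(𝔓)`

Topic `Literature/NumberTheory/LFunctions/Zhang2022` (Landau–Siegel adjudication tree; verdict-neutral;
leaf `Skeleton.Prop141` of the ZHANG-L discharge lane, rows G-L3t7-1 / G-adj2-4).
Y. Zhang, *Discrete mean estimates and the Landau–Siegel zero*, arXiv:2211.02515v1 (2022)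
[Zhang2022LandauSiegel] — **an unrefereed manuscript under adjudication; nothing here bears on its
Theorems 1–2 or on Landau–Siegel zeros.** §14 p. 76 (tex L3849–L3855): "We prove this proposition with
`β = 0` only, as the general case is almost identical. … Similar to the proof of Proposition 7.1, … we
can extend the sum over `Ψ₁` to the sum over `Ψ`, with acceptable errors. Namely we have
`Θ₂ = Σ_{ψ∈Ψ} Ĩ₂(ψ) + o(𝔓)`. (14.3)"

This file PROVES (theorems only; no new definition, no named fact):

* `Typed.Sec14.Eq143.sum_norm_i2Tilde_PsiTwo_le` — the ABSOLUTE form of the (14.3) error that the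
  tree's proof of (14.3) actually establishes (`Section14Eq143Assembly.dedEq143_of_tail`: `core` = Hölder
  + Lemma 3.3 (ii) + Prop. 2.1 on `𝔍(0)`, `shift`, `tail`, (7.4), `#Ψ₂ ≤ 𝔓`): for every `B`, `ε > 0`,
  eventually under (A), `Σ_{ψ∈Ψ₂} |Ĩ₂(ψ)| ≤ ε𝔓` for all `𝐤*, 𝐚*` subject to (14.1)–(14.2). The proof is
  that of `dedEq143_of_tail` verbatim, stopped one line earlier (before `|Σ| ≤ Σ|·|`).
* `Typed.Sec14.Eq143.eq143W` — **(14.3) at general `β`**: for `|β| < 5α`,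
  `‖Θ₂(β,𝐤*,𝐚*) − Σ_{ψ∈Ψ}(p_ψt₀)^β Ĩ₂(ψ)‖ ≤ ε𝔓` eventually (the difference is `−Σ_{ψ∈Ψ₂}(p_ψt₀)^β Ĩ₂(ψ)`
  and `|(pt₀)^β| ≤ e^{15π}` on the window, `norm_pt0_cpow_le`), i.e. the hypothesis `(14.3)ᵂ` of the
  general-`β` assembly `Typed.Sec14.prop141_of_parts` (file `Section14Prop141Twisted`; the weight there,
  `Typed.Sec14.wt D β p`, unfolds to the power written here).

## References

* Y. Zhang, arXiv:2211.02515v1 (2022), §14 (14.3) p. 76; §7 (7.3)–(7.5) pp. 34–35; §2 (2.8), (2.10).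
  [cite: Zhang2022LandauSiegel, §14 (14.3) p. 76, tex L3849–L3855]
-/

noncomputable section

open Complex Real Set MeasureTheory intervalIntegral
open scoped ComplexConjugate

namespace Literature.NumberTheory.LFunctions.Zhang2022.Typed.Sec14.Eq143

open Skeleton Section7aStatements Section7Eq73Edge

/-- `2πt₀ − 𝓛₁ > 0` for `𝓛 ≥ 1`. [folklore] -/
private theorem twoPiT0_sub_ell1_pos₄ {D : ℕ} (hℓ : 1 ≤ ell D) : 0 < 2 * π * t0 D - ell1 D := by
  have h1 : ell D ^ 405 ≤ ell D ^ 519 := pow_le_pow_right₀ hℓ (by norm_num)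
  have h2 : 1 ≤ ell D ^ 519 := one_le_pow₀ hℓ
  rw [t0, ell1]; nlinarith [Real.pi_gt_three]

/-- **The absolute (14.3) error**: for every `B` and `ε > 0`, for all large `D` under (A), every
`𝐤*, 𝐚*` subject to (14.1)–(14.2): `Σ_{ψ∈Ψ₂} |Ĩ₂(ψ)| ≤ ε𝔓`. This is exactly what the tree's proof of
(14.3) (`dedEq143_of_tail` with `core`, `shift`, `tail`, (7.4) `eq74_holds`, `#Ψ₂ ≤ 𝔓`) shows; the proof
below is that proof with the last step `|Σ| ≤ Σ|·|` removed.
[cite: Zhang2022LandauSiegel, §14 (14.3) p. 76; §7 (7.3)–(7.5) pp. 34–35] -/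
theorem sum_norm_i2Tilde_PsiTwo_le : ∀ B : ℝ, ∀ ε : ℝ, 0 < ε →
    ForAllLarge fun D _ χ => AssumptionA D χ → ∀ κs as : ℕ → ℂ, Eq141 B κs → Eq142 D B as →
      ∑ x ∈ finsetOf (PsiTwo χ), ‖i2Tilde χ x κs as‖ ≤ ε * frakP D := by
  intro B ε hε
  obtain ⟨K, D₁, Hcore⟩ := core prop21_holds lemma33b_holds B
  obtain ⟨C₇₄, D₂, H74⟩ := eq74_holds
  obtain ⟨Cs, D₃, Hs⟩ := shift B
  obtain ⟨Ct, D₄, Ht⟩ := tail B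
  set K' : ℝ := max K 0 with hK'
  set C' : ℝ := max C₇₄ 0 with hC'
  set M : ℝ := max 1 (max (2 * K' * C' / ε) (32 * (|Cs| + |Ct|) / ε)) with hMdef
  obtain ⟨D₅, H5⟩ := exists_nat_forall_le_ell M
  refine ⟨max (max (max D₁ D₂) (max D₃ D₄)) (max D₅ 3), fun D _ χ hD hq hp hA κs as hκ has => ?_⟩
  have hD12 : max D₁ D₂ ≤ D := le_trans (le_trans (le_max_left _ _) (le_max_left _ _)) hD
  have hD34 : max D₃ D₄ ≤ D := le_trans (le_trans (le_max_right _ _) (le_max_left _ _)) hD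
  have hD1 : D₁ ≤ D := le_trans (le_max_left _ _) hD12
  have hD2 : D₂ ≤ D := le_trans (le_max_right _ _) hD12
  have hD3 : D₃ ≤ D := le_trans (le_max_left _ _) hD34
  have hD4 : D₄ ≤ D := le_trans (le_max_right _ _) hD34
  have hD5 : D₅ ≤ D := le_trans (le_trans (le_max_left _ _) (le_max_right _ _)) hD
  have hD3' : 3 ≤ D := le_trans (le_trans (le_max_right _ _) (le_max_right _ _)) hD
  have hM := H5 D hD5
  have hℓ1 : 1 ≤ ell D := le_trans (le_max_left _ _) hM
  have hℓ0 : 0 < ell D := by linarith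
  have hL0 : 0 ≤ ell1 D := by rw [ell1]; positivity
  have hside : 0 < 2 * π * t0 D - ell1 D := twoPiT0_sub_ell1_pos₄ hℓ1
  -- notation
  set X : ℕ := ⌊bigP D ^ 2⌋₊ with hX
  set S := finsetOf (PsiTwo χ) with hSdef
  set e : ℝ := Real.exp (-(1 / 16) * ell D ^ 10) with hedef
  have he : 0 < e := Real.exp_pos _
  have hfrakP : 0 ≤ frakP D := le_trans (Nat.cast_nonneg _) (card_finsetOf_PsiTwo_le_frakP χ)
  -- the three integrands, per character
  set Mf : Chr D → ℂ → ℂ := fun x s =>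
    ∑ m ∈ Finset.Icc 1 X, κs m * x.ψ (m : ZMod x.p) * (m : ℂ) ^ (-s) with hMf
  set Lf : Chr D → ℂ → ℂ := fun x s =>
    LSeries (fun m : ℕ => if X < m then κs m * x.ψ (m : ZMod x.p) else 0) s with hLf
  set Af : Chr D → ℂ → ℂ := fun x s =>
    ∑ n ∈ Finset.Icc 1 ⌊2 * P4 D⌋₊, as n * conj (x.ψ (n : ZMod x.p)) * (n : ℂ) ^ (s - 1) with hAf
  set Ffull : Chr D → ℂ → ℂ := fun x s =>
    (Zpc χ x s)⁻¹ * (∑' m : ℕ, κs m * x.ψ (m : ZMod x.p) * (m : ℂ) ^ (-s)) * Af x s * omegaW D s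
    with hFfull
  set Ffin : Chr D → ℂ → ℂ := fun x s => (Zpc χ x s)⁻¹ * Mf x s * Af x s * omegaW D s with hFfin
  set Ftail : Chr D → ℂ → ℂ := fun x s => (Zpc χ x s)⁻¹ * Lf x s * Af x s * omegaW D s with hFtail
  have hI2 : ∀ x : Chr D, i2Tilde χ x κs as = Lemma81.segInt (t0 D) (ell1 D) 1 (Ffull x) :=
    fun x => rfl
  -- Step 2: on `𝔍(1)` the series splits, and so does the integral
  have hpt_re : ∀ v : ℝ, (((1 : ℝ) : ℂ) + s0 D + v * I).re = 3 / 2 := by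
    intro v; simp [s0, SmoothWeight.s0]; norm_num
  have hpt_im : ∀ v : ℝ, (((1 : ℝ) : ℂ) + s0 D + v * I).im = 2 * π * t0 D + v := by
    intro v; simp [s0, SmoothWeight.s0]
  have hsplit_pt : ∀ (x : Chr D) (v : ℝ),
      Ffull x (((1 : ℝ) : ℂ) + s0 D + v * I) =
        Ffin x (((1 : ℝ) : ℂ) + s0 D + v * I) + Ftail x (((1 : ℝ) : ℂ) + s0 D + v * I) := by
    intro x v
    have hs : 1 < (((1 : ℝ) : ℂ) + s0 D + v * I).re := by rw [hpt_re]; norm_num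
    simp only [hFfull, hFfin, hFtail, hMf, hLf]
    rw [tsum_twist_eq_head_add_LSeries x hκ X hs]; ring
  -- continuity of the integrands along `𝔍(1)` (for `|v| ≤ 𝓛₁`, where `Im s > 0`)
  have hopen : IsOpen {s : ℂ | 1 < s.re} := isOpen_lt continuous_const Complex.continuous_re
  have hcont : ∀ (x : Chr D) (G : ℂ → ℂ), DifferentiableOn ℂ G {s : ℂ | 1 < s.re} →
      ContinuousOn (fun v : ℝ => (Zpc χ x (((1 : ℝ) : ℂ) + s0 D + v * I))⁻¹ *
        G (((1 : ℝ) : ℂ) + s0 D + v * I) * Af x (((1 : ℝ) : ℂ) + s0 D + v * I) *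
        omegaW D (((1 : ℝ) : ℂ) + s0 D + v * I)) (Set.uIcc (-ell1 D) (ell1 D)) := by
    intro x G hG v hv
    rw [Set.uIcc_of_le (by linarith)] at hv
    have him : 0 < (((1 : ℝ) : ℂ) + s0 D + v * I).im := by rw [hpt_im]; linarith [hv.1]
    have hre : (((1 : ℝ) : ℂ) + s0 D + v * I) ∈ {s : ℂ | 1 < s.re} := by
      rw [Set.mem_setOf_eq, hpt_re]; norm_num
    have hpt : ContinuousAt (fun v : ℝ => ((1 : ℝ) : ℂ) + s0 D + v * I) v :=
      (continuous_segPoint (D := D) 1).continuousAt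
    have h1 : ContinuousAt (fun s => (Zpc χ x s)⁻¹) (((1 : ℝ) : ℂ) + s0 D + v * I) :=
      (differentiableAt_Zpc_inv hD3' hp x him).continuousAt
    have h2 : ContinuousAt G (((1 : ℝ) : ℂ) + s0 D + v * I) :=
      (hG.differentiableAt (hopen.mem_nhds hre)).continuousAt
    have h3 : ContinuousAt (Af x) (((1 : ℝ) : ℂ) + s0 D + v * I) :=
      ((differentiable_apoly x as).continuous).continuousAt
    have h4 : ContinuousAt (omegaW D) (((1 : ℝ) : ℂ) + s0 D + v * I) :=
      ((differentiable_omegaW D).continuous).continuousAt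
    have h1' : ContinuousAt (fun v : ℝ => (Zpc χ x (((1 : ℝ) : ℂ) + s0 D + v * I))⁻¹) v :=
      ContinuousAt.comp (f := fun v : ℝ => ((1 : ℝ) : ℂ) + s0 D + v * I) h1 hpt
    have h2' : ContinuousAt (fun v : ℝ => G (((1 : ℝ) : ℂ) + s0 D + v * I)) v :=
      ContinuousAt.comp (f := fun v : ℝ => ((1 : ℝ) : ℂ) + s0 D + v * I) h2 hpt
    have h3' : ContinuousAt (fun v : ℝ => Af x (((1 : ℝ) : ℂ) + s0 D + v * I)) v :=
      ContinuousAt.comp (f := fun v : ℝ => ((1 : ℝ) : ℂ) + s0 D + v * I) h3 hpt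
    have h4' : ContinuousAt (fun v : ℝ => omegaW D (((1 : ℝ) : ℂ) + s0 D + v * I)) v :=
      ContinuousAt.comp (f := fun v : ℝ => ((1 : ℝ) : ℂ) + s0 D + v * I) h4 hpt
    exact (((h1'.mul h2').mul h3').mul h4').continuousWithinAt
  have hint_fin : ∀ x : Chr D, IntervalIntegrable
      (fun v : ℝ => Ffin x (((1 : ℝ) : ℂ) + s0 D + v * I)) volume (-ell1 D) (ell1 D) := fun x =>
    (hcont x (Mf x) ((differentiable_head x κs).differentiableOn)).intervalIntegrable
  have hint_tail : ∀ x : Chr D, IntervalIntegrable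
      (fun v : ℝ => Ftail x (((1 : ℝ) : ℂ) + s0 D + v * I)) volume (-ell1 D) (ell1 D) := fun x =>
    (hcont x (Lf x) (differentiableOn_LSeries_tail x hκ X)).intervalIntegrable
  have hsplit : ∀ x : Chr D, intJ D 1 (Ffull x) = intJ D 1 (Ffin x) + intJ D 1 (Ftail x) := by
    intro x
    have e1 : (∫ v in (-ell1 D)..ell1 D, Ffull x (((1 : ℝ) : ℂ) + s0 D + v * I)) =
        ∫ v in (-ell1 D)..ell1 D, (Ffin x (((1 : ℝ) : ℂ) + s0 D + v * I) +
          Ftail x (((1 : ℝ) : ℂ) + s0 D + v * I)) :=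
      intervalIntegral.integral_congr fun v _ => hsplit_pt x v
    show 2 * π * I * ((1 / (2 * π) : ℂ) * ∫ v in (-ell1 D)..ell1 D,
        Ffull x (((1 : ℝ) : ℂ) + s0 D + v * I)) =
      2 * π * I * ((1 / (2 * π) : ℂ) * ∫ v in (-ell1 D)..ell1 D,
        Ffin x (((1 : ℝ) : ℂ) + s0 D + v * I)) +
      2 * π * I * ((1 / (2 * π) : ℂ) * ∫ v in (-ell1 D)..ell1 D,
        Ftail x (((1 : ℝ) : ℂ) + s0 D + v * I))
    rw [e1, intervalIntegral.integral_add (hint_fin x) (hint_tail x)]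
    ring
  -- Step 3: the per-character bounds
  have hfinx : ∀ x : Chr D, ‖intJ D 1 (Ffin x)‖ ≤
      absIntJ D 0 (fun s => Mf x s * (Af x s * omegaW D s)) + Cs * e :=
    fun x => Hs D χ hD3 hq hp x κs as hκ has.1
  have htailx : ∀ x : Chr D, ‖intJ D 1 (Ftail x)‖ ≤ Ct * e :=
    fun x => Ht D χ hD4 hq hp x κs as hκ has.1
  have hperx : ∀ x : Chr D, ‖i2Tilde χ x κs as‖ ≤
      absIntJ D 0 (fun s => Mf x s * (Af x s * omegaW D s)) + (Cs + Ct) * e := by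
    intro x
    calc ‖i2Tilde χ x κs as‖ ≤ ‖intJ D 1 (Ffull x)‖ := by
          rw [hI2]; exact norm_segInt_le_norm_intJ D 1 (Ffull x)
      _ = ‖intJ D 1 (Ffin x) + intJ D 1 (Ftail x)‖ := by rw [hsplit]
      _ ≤ ‖intJ D 1 (Ffin x)‖ + ‖intJ D 1 (Ftail x)‖ := norm_add_le _ _
      _ ≤ absIntJ D 0 (fun s => Mf x s * (Af x s * omegaW D s)) + Cs * e + Ct * e :=
          add_le_add (hfinx x) (htailx x)
      _ = _ := by ring
  -- Step 4: the sum over `Ψ₂` of the `𝔍(0)`-integrals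
  have hω : Continuous fun v : ℝ => ‖omegaW D (((0 : ℝ) : ℂ) + s0 D + v * I)‖ :=
    (continuous_omegaW_seg (D := D) 0).norm
  have hG : ∀ x : Chr D, Continuous fun v : ℝ =>
      ‖Mf x (((0 : ℝ) : ℂ) + s0 D + v * I) *
        (Af x (((0 : ℝ) : ℂ) + s0 D + v * I) * omegaW D (((0 : ℝ) : ℂ) + s0 D + v * I))‖ := by
    intro x
    have hpt := continuous_segPoint (D := D) 0
    exact (((differentiable_head x κs).continuous.comp hpt).mul
      (((differentiable_apoly x as).continuous.comp hpt).mul (continuous_omegaW_seg (D := D) 0))).norm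
  have hℓℓ : -ell1 D ≤ ell1 D := by linarith
  have hmain : ∑ x ∈ S, absIntJ D 0 (fun s => Mf x s * (Af x s * omegaW D s)) ≤
      K' * frakP D * (ell D ^ 5)⁻¹ * C' := by
    have hswap : ∑ x ∈ S, absIntJ D 0 (fun s => Mf x s * (Af x s * omegaW D s)) =
        ∫ v in (-ell1 D)..ell1 D, ∑ x ∈ S,
          ‖Mf x (((0 : ℝ) : ℂ) + s0 D + v * I) *
            (Af x (((0 : ℝ) : ℂ) + s0 D + v * I) * omegaW D (((0 : ℝ) : ℂ) + s0 D + v * I))‖ := by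
      rw [intervalIntegral.integral_finsetSum fun x _ => (hG x).intervalIntegrable _ _]
      rfl
    rw [hswap]
    have hpt : ∀ v : ℝ, ∑ x ∈ S,
        ‖Mf x (((0 : ℝ) : ℂ) + s0 D + v * I) *
          (Af x (((0 : ℝ) : ℂ) + s0 D + v * I) * omegaW D (((0 : ℝ) : ℂ) + s0 D + v * I))‖ ≤
        K' * frakP D * (ell D ^ 5)⁻¹ * ‖omegaW D (((0 : ℝ) : ℂ) + s0 D + v * I)‖ := by
      intro v
      have h := Hcore D χ hD1 hq hp hA κs as hκ has _ (segPoint_zero_re (D := D) v)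
      have e1 : ∑ x ∈ S,
          ‖Mf x (((0 : ℝ) : ℂ) + s0 D + v * I) *
            (Af x (((0 : ℝ) : ℂ) + s0 D + v * I) * omegaW D (((0 : ℝ) : ℂ) + s0 D + v * I))‖ =
          (∑ x ∈ S, ‖Mf x (((0 : ℝ) : ℂ) + s0 D + v * I)‖ *
            ‖Af x (((0 : ℝ) : ℂ) + s0 D + v * I)‖) * ‖omegaW D (((0 : ℝ) : ℂ) + s0 D + v * I)‖ := by
        rw [Finset.sum_mul]
        exact Finset.sum_congr rfl fun x _ => by rw [norm_mul, norm_mul, mul_assoc]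
      rw [e1]
      refine mul_le_mul_of_nonneg_right (h.trans ?_) (norm_nonneg _)
      have : K * frakP D * (ell D ^ 5)⁻¹ ≤ K' * frakP D * (ell D ^ 5)⁻¹ := by
        have hK : K ≤ K' := le_max_left _ _
        have h5 : 0 ≤ (ell D ^ 5)⁻¹ := by positivity
        nlinarith [mul_nonneg hfrakP h5]
      exact this
    calc ∫ v in (-ell1 D)..ell1 D, ∑ x ∈ S,
          ‖Mf x (((0 : ℝ) : ℂ) + s0 D + v * I) *
            (Af x (((0 : ℝ) : ℂ) + s0 D + v * I) * omegaW D (((0 : ℝ) : ℂ) + s0 D + v * I))‖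
        ≤ ∫ v in (-ell1 D)..ell1 D,
            K' * frakP D * (ell D ^ 5)⁻¹ * ‖omegaW D (((0 : ℝ) : ℂ) + s0 D + v * I)‖ :=
          intervalIntegral.integral_mono_on hℓℓ
            ((continuous_finsetSum _ fun x _ => hG x).intervalIntegrable _ _)
            ((continuous_const.mul hω).intervalIntegrable _ _) (fun v _ => hpt v)
      _ = K' * frakP D * (ell D ^ 5)⁻¹ * absIntJ D 0 (omegaW D) := by
          rw [intervalIntegral.integral_const_mul]; rfl
      _ ≤ K' * frakP D * (ell D ^ 5)⁻¹ * C' :=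
          mul_le_mul_of_nonneg_left ((H74 D χ hD2 hq hp 0 (by
            rw [abs_zero]; positivity)).trans (le_max_left _ _))
            (mul_nonneg (mul_nonneg (le_max_right _ _) hfrakP) (by positivity))
  -- Step 5: the accumulated per-character errors, `#Ψ₂ ≤ 𝔓`
  have hcount : (S.card : ℝ) * ((Cs + Ct) * e) ≤ frakP D * ((|Cs| + |Ct|) * e) :=
    calc (S.card : ℝ) * ((Cs + Ct) * e) ≤ (S.card : ℝ) * ((|Cs| + |Ct|) * e) :=
          mul_le_mul_of_nonneg_left (mul_le_mul_of_nonneg_right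
            (add_le_add (le_abs_self _) (le_abs_self _)) he.le) (Nat.cast_nonneg _)
      _ ≤ frakP D * ((|Cs| + |Ct|) * e) :=
          mul_le_mul_of_nonneg_right (card_finsetOf_PsiTwo_le_frakP χ) (by positivity)
  -- Step 6: smallness for `𝓛 ≥ M`
  have hsmall1 : K' * (ell D ^ 5)⁻¹ * C' ≤ ε / 2 := by
    have hKC : 0 ≤ K' * C' := mul_nonneg (le_max_right _ _) (le_max_right _ _)
    have h1 : 2 * K' * C' / ε ≤ ell D := le_trans (le_trans (le_max_left _ _) (le_max_right _ _)) hM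
    have h2 : 2 * K' * C' ≤ ε * ell D := by rw [div_le_iff₀ hε] at h1; linarith
    have h5 : ell D ≤ ell D ^ 5 := le_self_pow₀ hℓ1 (by norm_num)
    have h5' : 0 < ell D ^ 5 := by positivity
    rw [show K' * (ell D ^ 5)⁻¹ * C' = K' * C' / ell D ^ 5 by ring, div_le_iff₀ h5']
    nlinarith
  have hsmall2 : (|Cs| + |Ct|) * e ≤ ε / 2 := by
    have hA0 : 0 ≤ |Cs| + |Ct| := by positivity
    have h1 : 32 * (|Cs| + |Ct|) / ε ≤ ell D :=
      le_trans (le_trans (le_max_right _ _) (le_max_right _ _)) hM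
    have h2 : 32 * (|Cs| + |Ct|) ≤ ε * ell D := by rw [div_le_iff₀ hε] at h1; linarith
    -- `e = exp(−𝓛¹⁰/16) ≤ exp(−𝓛/16) ≤ 16/𝓛`
    have h10 : ell D ≤ ell D ^ 10 := le_self_pow₀ hℓ1 (by norm_num)
    have he1 : e ≤ Real.exp (-(ell D / 16)) := Real.exp_le_exp.mpr (by nlinarith)
    have he2 : Real.exp (-(ell D / 16)) ≤ 16 / ell D := by
      have h := Real.add_one_le_exp (ell D / 16)
      rw [Real.exp_neg, inv_eq_one_div, div_le_div_iff₀ (Real.exp_pos _) hℓ0]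
      nlinarith
    have he3 : e ≤ 16 / ell D := he1.trans he2
    calc (|Cs| + |Ct|) * e ≤ (|Cs| + |Ct|) * (16 / ell D) := mul_le_mul_of_nonneg_left he3 hA0
      _ = 16 * (|Cs| + |Ct|) / ell D := by ring
      _ ≤ ε / 2 := by rw [div_le_iff₀ hℓ0]; nlinarith
  -- assemble
  calc ∑ x ∈ S, ‖i2Tilde χ x κs as‖
      ≤ ∑ x ∈ S, (absIntJ D 0 (fun s => Mf x s * (Af x s * omegaW D s)) + (Cs + Ct) * e) :=
        Finset.sum_le_sum fun x _ => hperx x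
    _ = ∑ x ∈ S, absIntJ D 0 (fun s => Mf x s * (Af x s * omegaW D s)) +
          (S.card : ℝ) * ((Cs + Ct) * e) := by
        rw [Finset.sum_add_distrib, Finset.sum_const, nsmul_eq_mul]
    _ ≤ K' * frakP D * (ell D ^ 5)⁻¹ * C' + frakP D * ((|Cs| + |Ct|) * e) := add_le_add hmain hcount
    _ = frakP D * (K' * (ell D ^ 5)⁻¹ * C') + frakP D * ((|Cs| + |Ct|) * e) := by ring
    _ ≤ frakP D * (ε / 2) + frakP D * (ε / 2) :=
        add_le_add (mul_le_mul_of_nonneg_left hsmall1 hfrakP) (mul_le_mul_of_nonneg_left hsmall2 hfrakP)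
    _ = ε * frakP D := by ring


/-- **The twist is bounded on the window** (local copy of `Typed.Sec14.norm_wt_le`): for `𝓛 ≥ 3`,
`p ∼ P` and `|β| ≤ 5α`, `‖(pt₀)^β‖ ≤ e^{15π}` (`‖x^β‖ = x^{Re β}`, `1 ≤ pt₀`, `log(pt₀) ≤ 3𝓛⁹`,
`α𝓛⁹ = π`). [cite: Zhang2022LandauSiegel, §2 (2.8), (2.10); §14 p.76] -/
theorem norm_pt0_cpow_le {D p : ℕ} (hℓ : 3 ≤ ell D) (hp : p ∈ primeWindow D) {β : ℂ}
    (hβ : ‖β‖ ≤ 5 * alpha D) : ‖(((p : ℝ) * t0 D : ℝ) : ℂ) ^ β‖ ≤ Real.exp (15 * π) := by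
  have hℓ0 : 0 < ell D := by linarith
  have hℓ1 : 1 ≤ ell D := by linarith
  have hp0 : (0 : ℝ) < p := pos_of_mem_primeWindow hp
  have ht0 : 1 ≤ t0 D := by rw [t0]; exact one_le_pow₀ hℓ1
  set x : ℝ := (p : ℝ) * t0 D with hx
  have hx0 : 0 < x := by positivity
  have hP1 : 1 ≤ bigP D := by rw [bigP]; exact Real.one_le_exp (by positivity)
  have hp1 : 1 ≤ (p : ℝ) := hP1.trans (bigP_lt_of_mem_primeWindow hp).le
  have hx1 : 1 ≤ x := by rw [hx]; nlinarith
  have hnorm : ‖((x : ℝ) : ℂ) ^ β‖ = x ^ β.re := Complex.norm_cpow_eq_rpow_re_of_pos hx0 _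
  have hre : β.re ≤ 5 * alpha D := (Complex.re_le_norm β).trans hβ
  rw [hnorm]
  refine (Real.rpow_le_rpow_of_exponent_le hx1 hre).trans ?_
  have hlogp : Real.log p ≤ ell D ^ 9 + 1 := by
    have h1 := log_le_log_bigP_add_of_mem_primeWindow hℓ1 hp
    have h2 : (ell D ^ 68)⁻¹ ≤ 1 := inv_le_one_of_one_le₀ (one_le_pow₀ hℓ1)
    have h3 : Real.log (bigP D) = ell D ^ 9 := by rw [bigP, Real.log_exp]
    rw [h3] at h1
    linarith
  have hlogt : Real.log (t0 D) ≤ ell D ^ 9 := by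
    rw [t0, Real.log_pow]
    have h1 : Real.log (ell D) ≤ ell D := (Real.log_le_sub_one_of_pos hℓ0).trans (by linarith)
    have h8 : (519 : ℝ) ≤ ell D ^ 8 :=
      calc (519 : ℝ) ≤ 3 ^ 8 := by norm_num
        _ ≤ ell D ^ 8 := pow_le_pow_left₀ (by norm_num) hℓ 8
    calc (519 : ℕ) * Real.log (ell D) ≤ 519 * ell D := by
          push_cast; exact mul_le_mul_of_nonneg_left h1 (by norm_num)
      _ ≤ ell D ^ 8 * ell D := mul_le_mul_of_nonneg_right h8 hℓ0.le
      _ = ell D ^ 9 := by ring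
  have h9 : 1 ≤ ell D ^ 9 := one_le_pow₀ hℓ1
  have hlogx : Real.log x ≤ 3 * ell D ^ 9 := by
    rw [hx, Real.log_mul hp0.ne' (by positivity)]
    linarith
  have hα : 0 < alpha D := alpha_pos' hℓ0
  have hαlog : 5 * alpha D * Real.log x ≤ 15 * π := by
    have h1 : alpha D * ell D ^ 9 = π := by
      have := alpha_mul_log_bigP (D := D) hℓ0.ne'
      rwa [show Real.log (bigP D) = ell D ^ 9 by rw [bigP, Real.log_exp]] at this
    calc 5 * alpha D * Real.log x ≤ 5 * alpha D * (3 * ell D ^ 9) :=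
          mul_le_mul_of_nonneg_left hlogx (by positivity)
      _ = 15 * (alpha D * ell D ^ 9) := by ring
      _ = 15 * π := by rw [h1]
  rw [Real.rpow_def_of_pos hx0]
  exact Real.exp_le_exp.mpr (by rw [mul_comm]; exact hαlog)

/-- `Θ₂(β,𝐤*,𝐚*) = Σ_{ψ∈Ψ₁}(p_ψt₀)^β Ĩ₂(ψ)` (the banked `Skeleton.Theta2`, unfolded).
[cite: Zhang2022LandauSiegel, §14 u001 p.76, tex L3834] -/
theorem theta2_eq_sum_pow_mul_i2Tilde {D : ℕ} [NeZero D] (χ : DirichletCharacter ℂ D) (β : ℂ)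
    (κs as : ℕ → ℂ) :
    Theta2 χ β κs as =
      ∑ x ∈ finsetOf (PsiOne χ), (((x.p : ℝ) * t0 D : ℝ) : ℂ) ^ β * i2Tilde χ x κs as := by
  unfold Theta2 i2Tilde
  rfl

/-- **(14.3) at general `β`** ("the general case is almost identical", §14 p. 76): for every `B`,
`ε > 0`, for all large `D` under (A), every `|β| < 5α` and every `𝐤*, 𝐚*` subject to (14.1)–(14.2),
`‖Θ₂(β,𝐤*,𝐚*) − Σ_{ψ∈Ψ}(p_ψt₀)^β Ĩ₂(ψ)‖ ≤ ε𝔓`. Proof: the difference is `−Σ_{ψ∈Ψ₂}(p_ψt₀)^β Ĩ₂(ψ)`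
(`Ψ = Ψ₁ ⊔ Ψ₂`), `|(p_ψt₀)^β| ≤ e^{15π}` (`norm_pt0_cpow_le`) and `Σ_{Ψ₂}|Ĩ₂| ≤ (ε e^{−15π})𝔓`
(`sum_norm_i2Tilde_PsiTwo_le`). This is the hypothesis `(14.3)ᵂ` of `Typed.Sec14.prop141_of_parts`.
[cite: Zhang2022LandauSiegel, §14 (14.3) p. 76, tex L3849–L3855] -/
theorem eq143W : ∀ B : ℝ, ∀ ε : ℝ, 0 < ε →
    ForAllLarge fun D _ χ => AssumptionA D χ → ∀ β : ℂ, ‖β‖ < 5 * alpha D →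
      ∀ κs as : ℕ → ℂ, Eq141 B κs → Eq142 D B as →
        ‖Theta2 χ β κs as -
            ∑ x ∈ finsetOf (Set.univ : Set (Chr D)),
              (((x.p : ℝ) * t0 D : ℝ) : ℂ) ^ β * i2Tilde χ x κs as‖ ≤ ε * frakP D := by
  intro B ε hε
  set W : ℝ := Real.exp (15 * π) with hW
  have hW0 : 0 < W := Real.exp_pos _
  obtain ⟨D₀, h0⟩ := sum_norm_i2Tilde_PsiTwo_le B (ε / W) (div_pos hε hW0)
  obtain ⟨D₃, hD₃⟩ := exists_nat_forall_le_ell 3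
  refine ⟨max D₀ D₃, fun D _ χ hD hq hp hA β hβ κs as hκ has => ?_⟩
  have hℓ3 : 3 ≤ ell D := hD₃ D (le_trans (le_max_right _ _) hD)
  have hsum := h0 D χ (le_trans (le_max_left _ _) hD) hq hp hA κs as hκ has
  set S := finsetOf (PsiTwo χ) with hSdef
  have hdiff : Theta2 χ β κs as -
      ∑ x ∈ finsetOf (Set.univ : Set (Chr D)), (((x.p : ℝ) * t0 D : ℝ) : ℂ) ^ β * i2Tilde χ x κs as =
      -∑ x ∈ S, (((x.p : ℝ) * t0 D : ℝ) : ℂ) ^ β * i2Tilde χ x κs as := by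
    rw [theta2_eq_sum_pow_mul_i2Tilde, sum_finsetOf_univ_eq χ]; ring
  rw [hdiff, norm_neg]
  have hfrakP : 0 ≤ frakP D := le_trans (Nat.cast_nonneg _) (card_finsetOf_PsiTwo_le_frakP χ)
  calc ‖∑ x ∈ S, (((x.p : ℝ) * t0 D : ℝ) : ℂ) ^ β * i2Tilde χ x κs as‖
      ≤ ∑ x ∈ S, ‖(((x.p : ℝ) * t0 D : ℝ) : ℂ) ^ β * i2Tilde χ x κs as‖ := norm_sum_le _ _
    _ ≤ ∑ x ∈ S, W * ‖i2Tilde χ x κs as‖ := by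
        refine Finset.sum_le_sum fun x _ => ?_
        rw [norm_mul]
        exact mul_le_mul_of_nonneg_right (norm_pt0_cpow_le hℓ3 x.mem hβ.le) (norm_nonneg _)
    _ = W * ∑ x ∈ S, ‖i2Tilde χ x κs as‖ := by rw [Finset.mul_sum]
    _ ≤ W * (ε / W * frakP D) := mul_le_mul_of_nonneg_left hsum hW0.le
    _ = ε * frakP D := by field_simp

end Literature.NumberTheory.LFunctions.Zhang2022.Typed.Sec14.Eq143

end
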